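import Summits.QuantumFields.QCD.Theorems.SpectralDefectExtinctionExtinctionBuildsQCDStubHermitianWilsonCombesThomas
import Summits.QuantumFields.QCD.Theses.WilsonMobilityGap
import Literature.Barriers.QuantumFields.WilsonDeterminantSign
import Literature.Analysis.Matrix.CoerciveCombesThomas
import Literature.MathematicalPhysics.QuantumLattice.WilsonDiracRangeOne

/-!
# Crux `MobilityGap` (stmt-QuantumFields-9150), line `Ideator6Sketch`, stub `stub_pocketPlateau` (S1a) —
# the deterministic large-`|η|` regime of the reweighted valence fractional-moment bound (fragment)

The stub `stub_pocketPlateau` asks for an Aizenman–Molchanov bound, uniform in the torus and in `η > 0`,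
for the `|det D_W(U,x,1)|^{N_f}`-reweighted Wilson-measure fractional moment of the entries of the
VALENCE resolvent `(Γ₅ D_W(U,m₀,1) − E − iη)⁻¹` in the doubler pocket `m₀ ∈ [-3/2,-1]`.  Its small-`η`
part is open (no Wegner / fractional-moment theory for Gibbs-correlated `SU(3)` link disorder is in
print).  This file records the complementary regime, which is DETERMINISTIC and holds for every sea
mass, every valence mass, every energy, every coupling and every flavour number:

* `norm_inv_hermitianWilsonDirac_sub_apply_le` — Combes–Thomas off the real axis with an explicit
  floor: for `0 < η₀ ≤ 1`, `|η| ≥ η₀`, every torus, every `SU(3)` field `U`, all `m₀, E`: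
  `‖(Γ₅ D_W(U,m₀,1) − (E + iη))⁻¹(p,q)‖ ≤ (2/η₀) · exp(−(η₀/400) ‖p − q‖₁)` in the periodic taxi
  distance (floor `‖(H − E − iη)v‖² ≥ η²‖v‖²` for the Hermitian `H − E`; range one and off-site
  row/column sums `≤ 96` of `D_W`; `96 (e^{η₀/400} − 1) ≤ η₀/2`).  At `η₀ = 1`, `E = 0` this is the
  landed `stub_hermitianWilsonCombesThomas` (crux `ExtinctionBuildsQCD`, line `weyl-window`).
* `pocketPlateau_largeEta` — the registered fragment: the stub's reweighted quotient of integrals,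
  VERBATIM, is `≤ (2/η₀) · exp(−(s η₀/400) Σ_i |v_i|)` for all `0 ≤ s ≤ 1`, `0 < η₀ ≤ 1`, `|η| ≥ η₀`,
  all `N_f, β, x, m₀, S, E`, all displacements `|v_i| ≤ S` and all colour/spin indices.  The
  measure theory is weight-agnostic: the pointwise bound is integrated against the non-negative
  weight, and a vanishing or undefined normalisation makes the quotient `0`.

What remains of `stub_pocketPlateau` after this file is exactly its `0 < η < η₀` part, i.e. the
localisation content proper (the reweighted, `m₀`-uniform twin of
`IntegerCriticalLine.InteriorPlateauLocalisation`, stmt-QuantumFields-9690, open).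

References (prose): Combes–Thomas, Comm. Math. Phys. 34 (1973) 251; Aizenman–Graf, J. Phys. A 31
(1998) 6783, §2; Aizenman–Warzel, *Random Operators*, GSM 168 (2015), §10.3.
Pure theorem file (no definitions).
-/

noncomputable section

namespace Summit.QuantumFields.QCD.Theorems.MobilityGapPinch

open scoped BigOperators Topology ComplexConjugate
open MeasureTheory Filter Set Matrix Complex Finset
open Literature.MathematicalPhysics.QuantumFieldTheory Literature.MathematicalPhysics.QuantumLattice
  Literature.Probability.LatticeModels Literature.Barriers.QuantumFields.WilsonDeterminant
open Summit.QuantumFields.QCD.Cruxes.ExtinctionBuildsQCD.WeylWindow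

/-! ### Combes–Thomas for `Γ₅ D_W − (E + iη)` with an explicit floor `|η| ≥ η₀` -/

/-- A real shift of a Hermitian matrix is Hermitian: `(H − E·1)ᴴ = H − E·1` for real `E`. -/
theorem isHermitian_sub_ofReal_smul_one {n : Type*} [DecidableEq n] {H : Matrix n n ℂ} (hH : H.IsHermitian) (E : ℝ) :
    (H - (E : ℂ) • (1 : Matrix n n ℂ)).IsHermitian := by
  refine hH.sub ?_
  unfold Matrix.IsHermitian
  rw [conjTranspose_smul, conjTranspose_one, Complex.star_def, Complex.conj_ofReal]

/-- **Combes–Thomas for the Hermitian Wilson–Dirac resolvent off the real axis, explicit floor.**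
For `0 < η₀ ≤ 1`, every real `η` with `η₀ ≤ |η|`, every torus `(ℤ/L)⁴`, every `SU(3)` gauge field
`U`, every bare mass `m₀`, every real energy `E` and all colour–spin indices `p, q`:
`‖(Γ₅ D_W(U,m₀,1) − (E + iη))⁻¹(p,q)‖ ≤ (2/η₀) · exp(−(η₀/400) · ‖p.1 − q.1‖₁)` in the periodic taxi
distance — uniformly in `U`, `m₀`, `E`, `L`. [folklore] -/
theorem norm_inv_hermitianWilsonDirac_sub_apply_le {L : ℕ} [NeZero L]
    (U : GaugeConfig 4 L (Matrix.specialUnitaryGroup (Fin 3) ℂ)) (m₀ E η η₀ : ℝ)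
    (hη₀ : 0 < η₀) (hη₁ : η₀ ≤ 1) (hη : η₀ ≤ |η|) (p q : TorusSite 4 L × Fin 3 × Fin 4) :
    ‖(hermitianWilsonDirac (fundamentalRep (Fin 3)) U m₀ 1 -
        ((E : ℂ) + (η : ℂ) * Complex.I) •
          (1 : Matrix (TorusSite 4 L × Fin 3 × Fin 4) (TorusSite 4 L × Fin 3 × Fin 4) ℂ))⁻¹ p q‖ ≤
      2 / η₀ * Real.exp (-(η₀ / 400 * (torusTaxiDist p.1 q.1 : ℝ))) := by
  set H : Matrix (TorusSite 4 L × Fin 3 × Fin 4) (TorusSite 4 L × Fin 3 × Fin 4) ℂ :=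
    hermitianWilsonDirac (fundamentalRep (Fin 3)) U m₀ 1 with hHdef
  set A : Matrix (TorusSite 4 L × Fin 3 × Fin 4) (TorusSite 4 L × Fin 3 × Fin 4) ℂ :=
    H - ((E : ℂ) + (η : ℂ) * Complex.I) • 1 with hAdef
  have hρ : ∀ g : Matrix.specialUnitaryGroup (Fin 3) ℂ,
      fundamentalRep (Fin 3) g ∈ Matrix.unitaryGroup (Fin 3) ℂ :=
    fun g => fundamentalRep_mem_unitaryGroup g
  -- off-site entries of `A` are entries of `H_W`, with the moduli of `D_W`
  have hoff : ∀ p q : TorusSite 4 L × Fin 3 × Fin 4, p ≠ q →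
      ‖A p q‖ = ‖wilsonDirac (fundamentalRep (Fin 3)) U m₀ 1 p q‖ := by
    intro p q hpq
    rw [hAdef, Matrix.sub_apply, Matrix.smul_apply, one_apply_ne hpq, smul_zero, sub_zero, hHdef,
      hermitianWilsonDirac, ct_norm_hW_apply]
  -- range one in the taxi distance of the sites
  have hrange : ∀ p q : TorusSite 4 L × Fin 3 × Fin 4, A p q ≠ 0 → torusTaxiDist p.1 q.1 ≤ 1 := by
    intro p q h
    by_cases hpq : p = q
    · rw [hpq, torusTaxiDist_self]; exact zero_le_one
    · refine torusTaxiDist_le_one_of_wilsonDirac_ne_zero (fundamentalRep (Fin 3)) hρ U m₀ p q ?_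
      intro h0
      exact h (norm_eq_zero.1 (by rw [hoff p q hpq, h0, norm_zero]))
  -- off-site row and column sums `≤ 96`
  have hrow : ∀ p, ∑ q ∈ univ.filter (fun q : TorusSite 4 L × Fin 3 × Fin 4 => torusTaxiDist p.1 q.1 ≠ 0),
      ‖A p q‖ ≤ 96 := by
    intro p
    calc _ = ∑ q ∈ univ.filter (fun q : TorusSite 4 L × Fin 3 × Fin 4 => torusTaxiDist p.1 q.1 ≠ 0),
          ‖wilsonDirac (fundamentalRep (Fin 3)) U m₀ 1 p q‖ := by
          refine Finset.sum_congr rfl fun q hq => hoff p q ?_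
          rintro rfl
          exact (Finset.mem_filter.1 hq).2 (torusTaxiDist_self _)
      _ ≤ 32 * (3 : ℕ) := wilsonDirac_rowSum_torusTaxiDist_le (fundamentalRep (Fin 3)) hρ U m₀ p
      _ = 96 := by norm_num
  have hcol : ∀ q, ∑ p ∈ univ.filter (fun p : TorusSite 4 L × Fin 3 × Fin 4 => torusTaxiDist p.1 q.1 ≠ 0),
      ‖A p q‖ ≤ 96 := by
    intro q
    calc _ = ∑ p ∈ univ.filter (fun p : TorusSite 4 L × Fin 3 × Fin 4 => torusTaxiDist p.1 q.1 ≠ 0),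
          ‖wilsonDirac (fundamentalRep (Fin 3)) U m₀ 1 p q‖ := by
          refine Finset.sum_congr rfl fun p hp => hoff p q ?_
          rintro rfl
          exact (Finset.mem_filter.1 hp).2 (torusTaxiDist_self _)
      _ ≤ 32 * (3 : ℕ) := wilsonDirac_colSum_torusTaxiDist_le (fundamentalRep (Fin 3)) hρ U m₀ q
      _ = 96 := by norm_num
  -- the floor with `g = η₀`: `‖(H − E − iη) v‖² ≥ η² ‖v‖² ≥ η₀² ‖v‖²` (`H − E` is Hermitian)
  have hfloor : ∀ v : TorusSite 4 L × Fin 3 × Fin 4 → ℂ,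
      η₀ ^ 2 * ∑ i, ‖v i‖ ^ 2 ≤ ∑ i, ‖(A *ᵥ v) i‖ ^ 2 := by
    intro v
    have hHE : (H - (E : ℂ) • (1 : Matrix _ _ ℂ)).IsHermitian :=
      isHermitian_sub_ofReal_smul_one
        (isHermitian_hermitianWilsonDirac (fundamentalRep (Fin 3)) hρ U m₀ 1) E
    have h1 := sq_mul_sum_norm_sq_le_of_isHermitian hHE η v
    have hA : A = H - (E : ℂ) • (1 : Matrix _ _ ℂ) - ((η : ℂ) * Complex.I) • 1 := by
      rw [hAdef, add_smul, sub_sub]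
    have hN : 0 ≤ ∑ i, ‖v i‖ ^ 2 := Finset.sum_nonneg fun i _ => by positivity
    have hη2 : η₀ ^ 2 ≤ η ^ 2 := by
      rw [← sq_abs η]
      exact pow_le_pow_left₀ hη₀.le hη 2
    calc η₀ ^ 2 * ∑ i, ‖v i‖ ^ 2 ≤ η ^ 2 * ∑ i, ‖v i‖ ^ 2 := mul_le_mul_of_nonneg_right hη2 hN
      _ ≤ _ := by rw [hA]; exact h1
  -- the rate `θ = η₀/400`: `96 (e^θ − 1) ≤ 192 θ ≤ η₀/2`
  have hθ0 : (0 : ℝ) ≤ η₀ / 400 := by positivity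
  have hθ : (96 : ℝ) * (Real.exp (η₀ / 400) - 1) ≤ η₀ / 2 := by
    have h1 := Real.abs_exp_sub_one_le (x := η₀ / 400) (by rw [abs_of_nonneg hθ0]; linarith)
    rw [abs_of_nonneg hθ0, abs_of_nonneg (by linarith [Real.add_one_le_exp (η₀ / 400 : ℝ)])] at h1
    linarith
  obtain ⟨-, hB⟩ := Literature.Analysis.Matrix.coercive_combes_thomas
    (fun p q : TorusSite 4 L × Fin 3 × Fin 4 => torusTaxiDist p.1 q.1)
    (fun p => torusTaxiDist_self p.1) (fun p q => torusTaxiDist_comm p.1 q.1)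
    (fun p q r => torusDistOne_triangle (Ls := fun _ : Fin 4 => L) p.1 q.1 r.1)
    A hrange 96 hrow hcol η₀ (η₀ / 400) hη₀ hθ0 hfloor hθ
  exact hB p q

/-! ### The reweighted fractional moment in the regime `|η| ≥ η₀` -/

/-- **Fragment of `stub_pocketPlateau` (S1a), the deterministic regime `|η| ≥ η₀`.**  For every
flavour number `N_f`, coupling `β`, sea mass `x`, exponent `0 ≤ s ≤ 1`, floor `0 < η₀ ≤ 1`, valence
mass `m₀`, torus of side `2S+1`, energy `E`, every `η` with `η₀ ≤ |η|`, every displacement `v` with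
`|v_i| ≤ S` and all colour/spin indices, the `|det D_W(U,x,1)|^{N_f}`-reweighted Wilson-measure
`s`-moment of the `(0,a,α; v,b,γ)` entry of `(Γ₅ D_W(U,m₀,1) − E − iη)⁻¹` (the stub's quotient of
integrals, verbatim) is `≤ (2/η₀) · exp(−(s η₀/400) Σ_i |v_i|)`.  Combes–Thomas entry by entry
(`norm_inv_hermitianWilsonDirac_sub_apply_le`) integrated against the non-negative weight; on the
odd torus the taxi distance from `0` to the class of `v ∈ [-S,S]⁴` is `Σ_i |v_i|`. [folklore] -/
theorem pocketPlateau_largeEta : ∀ (Nf : ℕ) (β x s η₀ : ℝ), 0 ≤ s → s ≤ 1 → 0 < η₀ → η₀ ≤ 1 →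
    ∀ (m₀ : ℝ) (S : ℕ) (E η : ℝ), η₀ ≤ |η| → ∀ v : Fin 4 → ℤ, (∀ i, |v i| ≤ S) →
      ∀ (a b : Fin 3) (α γ : Fin 4),
        (∫ U : GaugeConfig 4 (2 * S + 1) (Matrix.specialUnitaryGroup (Fin 3) ℂ),
            ‖fermionDet (wilsonDirac (fundamentalRep (Fin 3)) U x 1)‖ ^ Nf *
              ‖(hermitianWilsonDirac (fundamentalRep (Fin 3)) U m₀ 1 -
                  ((E : ℂ) + (η : ℂ) * Complex.I) • (1 : Matrix (TorusSite 4 (2 * S + 1) × Fin 3 × Fin 4)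
                    (TorusSite 4 (2 * S + 1) × Fin 3 × Fin 4) ℂ))⁻¹
                ((0 : TorusSite 4 (2 * S + 1)), a, α) (Torus.proj (2 * S + 1) v, b, γ)‖ ^ s
            ∂(wilsonMeasure (d := 4) (L := 2 * S + 1) (fundamentalRep (Fin 3)) β)) /
          (∫ U : GaugeConfig 4 (2 * S + 1) (Matrix.specialUnitaryGroup (Fin 3) ℂ),
            ‖fermionDet (wilsonDirac (fundamentalRep (Fin 3)) U x 1)‖ ^ Nf
            ∂(wilsonMeasure (d := 4) (L := 2 * S + 1) (fundamentalRep (Fin 3)) β)) ≤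
        2 / η₀ * Real.exp (-(s * η₀ / 400 * ∑ i, |(v i : ℝ)|)) := by
  intro Nf β x s η₀ hs0 hs1 hη₀ hη₁ m₀ S E η hη v hv a b α γ
  -- abbreviations
  set μW : Measure (GaugeConfig 4 (2 * S + 1) (Matrix.specialUnitaryGroup (Fin 3) ℂ)) :=
    wilsonMeasure (d := 4) (L := 2 * S + 1) (fundamentalRep (Fin 3)) β with hμW
  set f : GaugeConfig 4 (2 * S + 1) (Matrix.specialUnitaryGroup (Fin 3) ℂ) → ℝ :=
    fun U => ‖fermionDet (wilsonDirac (fundamentalRep (Fin 3)) U x 1)‖ ^ Nf with hf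
  set X : GaugeConfig 4 (2 * S + 1) (Matrix.specialUnitaryGroup (Fin 3) ℂ) → ℝ :=
    fun U => ‖(hermitianWilsonDirac (fundamentalRep (Fin 3)) U m₀ 1 -
      ((E : ℂ) + (η : ℂ) * Complex.I) • (1 : Matrix (TorusSite 4 (2 * S + 1) × Fin 3 × Fin 4)
        (TorusSite 4 (2 * S + 1) × Fin 3 × Fin 4) ℂ))⁻¹
      ((0 : TorusSite 4 (2 * S + 1)), a, α) (Torus.proj (2 * S + 1) v, b, γ)‖ with hX
  -- the distance from `0` to the class of `v` is `Σ |v_i|`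
  have hdist : ((torusTaxiDist (0 : TorusSite 4 (2 * S + 1)) (Torus.proj (2 * S + 1) v) : ℕ) : ℝ) =
      ∑ i, |(v i : ℝ)| :=
    cast_torusDistOne_zero_proj S v hv
  -- the pointwise (deterministic) bound
  set K : ℝ := 2 / η₀ with hK
  have hK1 : 1 ≤ K := by
    rw [hK, le_div_iff₀ hη₀]; linarith
  set e : ℝ := Real.exp (-(η₀ / 400 * ∑ i, |(v i : ℝ)|)) with he
  have hepos : 0 < e := Real.exp_pos _
  have hXle : ∀ U, X U ≤ K * e := by
    intro U
    have h := norm_inv_hermitianWilsonDirac_sub_apply_le U m₀ E η η₀ hη₀ hη₁ hη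
      ((0 : TorusSite 4 (2 * S + 1)), a, α) (Torus.proj (2 * S + 1) v, b, γ)
    rw [hdist] at h
    exact h
  -- its fractional power: `X^s ≤ (K e)^s = K^s e^s ≤ K e^s`
  set B₀ : ℝ := K * Real.exp (-(s * η₀ / 400 * ∑ i, |(v i : ℝ)|)) with hB₀
  have hB₀0 : 0 ≤ B₀ := by rw [hB₀]; exact mul_nonneg (by linarith) (Real.exp_pos _).le
  have hXs : ∀ U, X U ^ s ≤ B₀ := by
    intro U
    have hX0 : 0 ≤ X U := norm_nonneg _
    calc X U ^ s ≤ (K * e) ^ s := Real.rpow_le_rpow hX0 (hXle U) hs0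
      _ = K ^ s * e ^ s := Real.mul_rpow (by linarith) hepos.le
      _ ≤ K * e ^ s :=
          mul_le_mul_of_nonneg_right (Real.rpow_le_self_of_one_le hK1 hs1) (Real.rpow_nonneg hepos.le _)
      _ = B₀ := by
          rw [hB₀, he, ← Real.exp_mul]
          congr 2
          ring
  -- pointwise bound of the integrand
  have hf0 : ∀ U, 0 ≤ f U := fun U => pow_nonneg (norm_nonneg _) _
  have hpt : ∀ U, f U * X U ^ s ≤ f U * B₀ := fun U => mul_le_mul_of_nonneg_left (hXs U) (hf0 U)
  -- the normalisation
  have hZ0 : 0 ≤ ∫ U, f U ∂μW := integral_nonneg hf0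
  show (∫ U, f U * X U ^ s ∂μW) / (∫ U, f U ∂μW) ≤ B₀
  rcases hZ0.eq_or_lt with hZ | hZ
  · rw [← hZ, div_zero]
    exact hB₀0
  · -- a positive normalisation forces integrability of the weight
    have hfi : Integrable f μW := by
      by_contra h
      exact hZ.ne' (integral_undef h)
    have hnum : ∫ U, f U * X U ^ s ∂μW ≤ (∫ U, f U ∂μW) * B₀ := by
      rw [← integral_mul_const]
      exact integral_mono_of_nonneg
        (Eventually.of_forall fun U => mul_nonneg (hf0 U) (Real.rpow_nonneg (norm_nonneg _) _))
        (hfi.mul_const B₀) (Eventually.of_forall hpt)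
    rw [div_le_iff₀ hZ]
    exact hnum.trans_eq (mul_comm _ _)

end Summit.QuantumFields.QCD.Theorems.MobilityGapPinch

end
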